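import Literature.IUT.HodgeTheaters.ProfiniteCompletionFunctorial
import Literature.IUT.HodgeTheaters.ProfiniteCompletionSurfaceBasisCharactersFcov
import Literature.IUT.HodgeTheaters.ProfiniteCompletionSubgroups
import Literature.IUT.HodgeTheaters.SurfaceGroupFiniteIndexBridge
import Literature.IUT.HodgeTheaters.SurfaceGroupLemma27
import Literature.IUT.HodgeTheaters.DiscreteProfiniteConjugatesSurfaceFacts
import Literature.GroupTheory.CombinatorialGroupTheory.SurfaceGroupFiniteIndexSubgroupHolds
import HarnessLib

/-!
# [IUTchI] Lemma 2.7 (vi), (vii) for ORIENTABLE SURFACE GROUPS by the PRINTED route (p. 59) —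
# without [Stb2]; UNCONDITIONAL (F_cov is now a theorem of the tree)

Mochizuki, *Inter-universal Teichmüller theory I*, kurims manuscript (May 2020), §2, Lemma 2.7 (vi)(vii)
(statement p. 58, proof p. 59) [cite: Mochizuki2012, Lem 2.7(vi) p.59] (D-0012 claim key, status disputed —
the content of this file is plain combinatorial / profinite group theory and takes no side; Remark 2.8.1:
the surface case is off the route used in [IUTchI–IV]).

The named statements `FreeOrSurface.centralizerCommutatorKernelTrivial` (Lem 2.7 (vi): `Z_Ĝ(N̂) = 1`,
`N̂ = Ker(Ĝ ↠ Ĝ^{ab})`, `G` nonabelian free of finite rank or an orientable surface group) and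
`FreeOrSurface.autFixingCommutatorKernelTrivial` (Lem 2.7 (vii)) are theorems of the tree for FREE `G`
(abc-iut-L5-t9, `…_freeCase`), and for orientable surface groups the tree's route so far
(`DiscreteProfiniteConjugatesSurfaceHCS/Facts/Lemma27/Thm26Closers`) goes through Theorem 2.6 (b) and
therefore through the named classical fact `SurfaceGroupConjugacySeparable` ([Stb2] = Stebe 1972, FACT
F-2732, admitted) besides `SurfaceGroupFiniteIndexSubgroup` (F_cov, Riemann–Hurwitz).

THIS FILE follows the PRINTED proof of (vi) instead (p. 59), which does not use conjugacy separability: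
"`N` is nonabelian; by (iii) there exist a finite index subgroup `G₁ ⊆ G` equipped with a surjection
`β : G₁ ↠ ℤ × ℤ` and `x, y ∈ N ∩ G₁` with `β(x) = (1,0)`, `β(y) = (0,1)`; by (v) the closed subgroups
`T̂_x, T̂_y` topologically generated by `x, y` are normally terminal in `Ĝ₁`; this implies formally
`Z_Ĝ(N̂) ∩ Ĝ₁ ⊆ Z_{Ĝ₁}(T̂_x) ∩ Z_{Ĝ₁}(T̂_y) ⊆ T̂_x ∩ T̂_y = {1}`; since the abelianizations of all open
subgroups of `Ĝ` are torsion-free, `Z_Ĝ(N̂) = {1}`."  Inputs, all theorems of the tree: a non-commuting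
pair in `[G, G]` (abc-iut-L5-d2); Lemma 2.7 (iii) AS TYPED (abc-iut-L5-d1, `rankTwoInAbelianization_holds`);
separating characters of a finitely generated abelianization (abc-iut-L5-d2), upgraded here to the
printed `β` on a further finite-index subgroup (`exists_finiteIndex_kronecker`); the core of Lemma 2.7 (v)
for surface groups modulo F_cov (abc-iut-L5-t17 / w4-d053, `centralizer_le_of_zHat_of_noBasisCharacter`,
`noBasisCharacter_of_finiteIndexSubgroup`); the comparison `Ĝ₁ ≅ closure(η(G₁)) ⊆ Ĝ` (abc-iut-L5-d2) and
the cross-universe functoriality `ℤ̂ → Ĝ₁ → ℤ̂` (`ProfiniteCompletionFunctorial.lean`).  The last printed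
step (torsion-free abelianizations of open subgroups) is replaced by the equivalent-purpose SLIMNESS of
`Ĝ` (`isSlimGroup_profiniteCompletion_of_surface`, unconditional, from abc-iut-w5-d116's [AbsAnab] Lemma
1.3.1): `Z_Ĝ(N̂)` is normal and meets the open normal level subgroup `Ĝ(N₀) ⊆ Ĝ₁` trivially, hence
commutes with it, hence is trivial.

Main results: `FreeOrSurface.centralizerCommutatorKernel_eq_bot_surfaceCase_of_finiteIndexSubgroup`
and the named statements `FreeOrSurface.centralizerCommutatorKernelTrivial_of_finiteIndexSubgroup (hF)`,
`FreeOrSurface.autFixingCommutatorKernelTrivial_of_finiteIndexSubgroup (hF)` — Lemma 2.7 (vi)(vii) AS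
TYPED relative to the named fact `SurfaceGroupFiniteIndexSubgroup` (F_cov) — and, since F_cov is now a
THEOREM of the tree (abc-iut-L5-d3 / L5-t16, `surfaceGroupFiniteIndexSubgroup_holds`, Reidemeister–Schreier
route), the UNCONDITIONAL discharges `FreeOrSurface.centralizerCommutatorKernelTrivial_holds` and
`FreeOrSurface.autFixingCommutatorKernelTrivial_holds`: [IUTchI] Lemma 2.7 (vi) and (vii) AS TYPED, with
no hypotheses; [Stb2] is NOT used.  Proof-only file; no statement of the tree is restated.
-/

namespace Literature.IUT.HodgeTheaters

open CategoryTheory ProfiniteGrp ProfiniteGrp.ProfiniteCompletion Topology Multiplicative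
open Literature.GroupTheory.CombinatorialGroupTheory (SurfaceGroupFiniteIndexSubgroup)
open ProfiniteCompletion

universe u

/-! ### The printed `β : G₁ ↠ ℤ × ℤ` with `β(x) = (1,0)`, `β(y) = (0,1)` -/

/-- Dividing a character by `m` on the finite-index subgroup where it is divisible by `m`: for
`f : K → ℤ` and `m ≠ 0`, `L = f⁻¹(mℤ)` has finite index and carries `β = f / m : L → ℤ`.
[cite: Mochizuki2012, Lem 2.7(vi) p.59] -/
theorem exists_finiteIndex_div_hom (K : Type u) [Group K] (f : K →* Multiplicative ℤ) (m : ℤ)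
    (hm : m ≠ 0) :
    ∃ (L : Subgroup K) (_ : L.FiniteIndex) (β : L →* Multiplicative ℤ),
      (∀ k : K, k ∈ L ↔ m ∣ toAdd (f k)) ∧ ∀ k : L, toAdd (β k) * m = toAdd (f (k : K)) := by
  classical
  haveI : NeZero m.natAbs := ⟨Int.natAbs_ne_zero.mpr hm⟩
  let χ : K →* Multiplicative (ZMod m.natAbs) :=
    (Int.castAddHom (ZMod m.natAbs)).toMultiplicative.comp f
  have hχ : ∀ k : K, k ∈ χ.ker ↔ m ∣ toAdd (f k) := by
    intro k
    rw [MonoidHom.mem_ker]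
    change ofAdd (((toAdd (f k) : ℤ) : ZMod m.natAbs)) = 1 ↔ _
    rw [ofAdd_eq_one, ZMod.intCast_zmod_eq_zero_iff_dvd, Int.natAbs_dvd]
  refine ⟨χ.ker, inferInstance,
    { toFun := fun k => ofAdd (toAdd (f (k : K)) / m)
      map_one' := by simp
      map_mul' := fun k l => by
        rw [← ofAdd_add, Subgroup.coe_mul, map_mul, toAdd_mul,
          Int.add_ediv_of_dvd_left ((hχ k).mp k.2)] }, hχ, fun k => ?_⟩
  change toAdd (ofAdd (toAdd (f (k : K)) / m)) * m = _
  rw [toAdd_ofAdd]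
  exact Int.ediv_mul_cancel ((hχ k).mp k.2)

/-- **The surjection `β : G₁ ↠ ℤ × ℤ` of the printed proof** (p. 59: "a finite index subgroup `G₁ ⊆ G`
equipped with a surjection `β : G₁ ↠ ℤ × ℤ`, and elements `x, y` … such that `β(x) = (1,0)`,
`β(y) = (0,1)`"), obtained from the typed form of Lemma 2.7 (iii) — "the images of `a, b` in `K^{ab}`
satisfy no non-trivial relation", `K` finitely generated —: separating characters `f₁(a) ≠ 0 = f₁(b)`,
`f₂(b) ≠ 0 = f₂(a)` (abc-iut-L5-d2), divided by `f₁(a)`, `f₂(b)` on the finite-index subgroup where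
they are divisible. [cite: Mochizuki2012, Lem 2.7(vi) p.59] -/
theorem exists_finiteIndex_kronecker (K : Type u) [Group K] [Group.FG K] (a b : K)
    (hind : ∀ i j : ℤ, Abelianization.of a ^ i * Abelianization.of b ^ j = 1 → i = 0 ∧ j = 0) :
    ∃ (L : Subgroup K) (_ : L.FiniteIndex) (ha : a ∈ L) (hb : b ∈ L)
      (β₁ β₂ : L →* Multiplicative ℤ),
      β₁ ⟨a, ha⟩ = ofAdd 1 ∧ β₁ ⟨b, hb⟩ = 1 ∧ β₂ ⟨a, ha⟩ = 1 ∧ β₂ ⟨b, hb⟩ = ofAdd 1 := by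
  classical
  obtain ⟨f₁, hf₁a, hf₁b⟩ := exists_hom_ne_one_eq_one_of_fg K a b hind
  have hind' : ∀ i j : ℤ, Abelianization.of b ^ i * Abelianization.of a ^ j = 1 → i = 0 ∧ j = 0 :=
    fun i j h => ⟨(hind j i (by rwa [mul_comm] at h)).2, (hind j i (by rwa [mul_comm] at h)).1⟩
  obtain ⟨f₂, hf₂b, hf₂a⟩ := exists_hom_ne_one_eq_one_of_fg K b a hind'
  have hm₁ : toAdd (f₁ a) ≠ 0 := fun h => hf₁a (by rw [← ofAdd_toAdd (f₁ a), h, ofAdd_zero])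
  have hm₂ : toAdd (f₂ b) ≠ 0 := fun h => hf₂b (by rw [← ofAdd_toAdd (f₂ b), h, ofAdd_zero])
  obtain ⟨L₁, hL₁, γ₁, hL₁mem, hγ₁⟩ := exists_finiteIndex_div_hom K f₁ (toAdd (f₁ a)) hm₁
  obtain ⟨L₂, hL₂, γ₂, hL₂mem, hγ₂⟩ := exists_finiteIndex_div_hom K f₂ (toAdd (f₂ b)) hm₂
  haveI := hL₁; haveI := hL₂
  have ha₁ : a ∈ L₁ := (hL₁mem a).mpr dvd_rfl
  have ha₂ : a ∈ L₂ := (hL₂mem a).mpr (by rw [hf₂a, toAdd_one]; exact dvd_zero _)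
  have hb₁ : b ∈ L₁ := (hL₁mem b).mpr (by rw [hf₁b, toAdd_one]; exact dvd_zero _)
  have hb₂ : b ∈ L₂ := (hL₂mem b).mpr dvd_rfl
  refine ⟨L₁ ⊓ L₂, inferInstance, ⟨ha₁, ha₂⟩, ⟨hb₁, hb₂⟩,
    γ₁.comp (Subgroup.inclusion inf_le_left), γ₂.comp (Subgroup.inclusion inf_le_right),
    ?_, ?_, ?_, ?_⟩
  · have h := hγ₁ ⟨a, ha₁⟩
    change toAdd (γ₁ ⟨a, ha₁⟩) * toAdd (f₁ a) = toAdd (f₁ a) at h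
    have h1 : toAdd (γ₁ ⟨a, ha₁⟩) = 1 := mul_right_cancel₀ hm₁ (h.trans (one_mul _).symm)
    change γ₁ ⟨a, ha₁⟩ = ofAdd 1
    rw [← ofAdd_toAdd (γ₁ ⟨a, ha₁⟩), h1]
  · have h := hγ₁ ⟨b, hb₁⟩
    change toAdd (γ₁ ⟨b, hb₁⟩) * toAdd (f₁ a) = toAdd (f₁ b) at h
    rw [hf₁b, toAdd_one, mul_eq_zero] at h
    change γ₁ ⟨b, hb₁⟩ = 1
    rw [← ofAdd_toAdd (γ₁ ⟨b, hb₁⟩), h.resolve_right hm₁, ofAdd_zero]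
  · have h := hγ₂ ⟨a, ha₂⟩
    change toAdd (γ₂ ⟨a, ha₂⟩) * toAdd (f₂ b) = toAdd (f₂ a) at h
    rw [hf₂a, toAdd_one, mul_eq_zero] at h
    change γ₂ ⟨a, ha₂⟩ = 1
    rw [← ofAdd_toAdd (γ₂ ⟨a, ha₂⟩), h.resolve_right hm₂, ofAdd_zero]
  · have h := hγ₂ ⟨b, hb₂⟩
    change toAdd (γ₂ ⟨b, hb₂⟩) * toAdd (f₂ b) = toAdd (f₂ b) at h
    have h1 : toAdd (γ₂ ⟨b, hb₂⟩) = 1 := mul_right_cancel₀ hm₂ (h.trans (one_mul _).symm)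
    change γ₂ ⟨b, hb₂⟩ = ofAdd 1
    rw [← ofAdd_toAdd (γ₂ ⟨b, hb₂⟩), h1]

/-! ### `Z_Ĝ(N̂) ∩ Ĝ₁ = {1}` (p. 59) -/

/-- **`Z_Ĝ(N̂) ∩ Ĝ₁ ⊆ Z_{Ĝ₁}(T̂_x) ∩ Z_{Ĝ₁}(T̂_y) ⊆ T̂_x ∩ T̂_y = {1}`** (p. 59), abstract form.  Let
`K ⊆ G` be a finite-index subgroup with NO BASIS CHARACTER (hypothesis `hN`, the inline statement
discharged for surface groups modulo F_cov by `ProfiniteCompletion.noBasisCharacter_of_finiteIndexSubgroup`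
and giving `Z_{K̂}(T̂) ⊆ T̂` for every `T̂` on which some continuous `K̂ → ℤ̂` is bijective — the core of
Lemma 2.7 (v)), `a, b ∈ K` with `η(a), η(b) ∈ N̂`, and `β = (β₁, β₂) : K → ℤ × ℤ` with `β(a) = (1,0)`,
`β(b) = (0,1)`.  Then an element `z` of `Z_Ĝ(N̂)` lying in the closure of `η(K)` (`= Ĝ₁ ⊆ Ĝ`) is trivial:
`z = ι(w)` for the comparison `ι : K̂ ↪ Ĝ`; `w` centralises `T̂_a = im(ℤ̂ → K̂, 1 ↦ a)` (as
`ι(T̂_a) ⊆ N̂`), on which `β̂₁ : K̂ → ℤ̂` is bijective (`β̂₁ ∘ (1 ↦ a) = id` by uniqueness), so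
`w ∈ T̂_a`; likewise `w ∈ T̂_b ⊆ Ker β̂₁`; hence `β̂₁(w) = 1` and `w = 1`.
[cite: Mochizuki2012, Lem 2.7(vi) p.59] -/
theorem eq_one_of_mem_centralizer_commutatorKernel_of_mem_closure {G : Type u} [Group G]
    (K : Subgroup G) [K.FiniteIndex]
    (hN : ∀ (p : ℕ), p.Prime → ∀ (U : Subgroup (profiniteCompletion K)),
      (∃ N₁ : FiniteIndexNormalSubgroup K, ∀ x : profiniteCompletion K, x.val N₁ = 1 → x ∈ U) →
      ∀ (ψ : U →* Multiplicative (ZMod p) × Multiplicative (ZMod p)),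
      (∃ N₂ : FiniteIndexNormalSubgroup K,
        ∀ (x : profiniteCompletion K) (hx : x ∈ U), x.val N₂ = 1 → ψ ⟨x, hx⟩ = 1) →
      ∀ (τ κ : profiniteCompletion K) (hτ : τ ∈ U) (hκ : κ ∈ U), τ * κ = κ * τ →
      ψ ⟨τ, hτ⟩ = (ofAdd 1, 1) → ψ ⟨κ, hκ⟩ = (1, ofAdd 1) → False)
    (a b : K) (ha : toCompletion G (a : G) ∈ FreeOrSurface.commutatorKernel G)
    (hb : toCompletion G (b : G) ∈ FreeOrSurface.commutatorKernel G)
    (β₁ β₂ : K →* Multiplicative ℤ) (h1a : β₁ a = ofAdd 1) (h1b : β₁ b = 1) (h2a : β₂ a = 1)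
    (h2b : β₂ b = ofAdd 1) {z : profiniteCompletion G}
    (hz : z ∈ Subgroup.centralizer (FreeOrSurface.commutatorKernel G : Set (profiniteCompletion G)))
    (hzK : z ∈ closure (toCompletion G '' (K : Set G))) : z = 1 := by
  classical
  obtain ⟨ι, hιc, hιi, hιη, hιr⟩ := exists_comparison K
  rw [← hιr] at hzK
  obtain ⟨w, rfl⟩ := hzK
  -- the maps `ℤ̂ → K̂` (`1 ↦ a`, `1 ↦ b`) and `β̂₁, β̂₂ : K̂ → ℤ̂`
  obtain ⟨ιa, hιac, hιaη⟩ := exists_map_comp_toCompletion (zpowersHom K a)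
  obtain ⟨ιb, hιbc, hιbη⟩ := exists_map_comp_toCompletion (zpowersHom K b)
  obtain ⟨φ₁, hφ₁c, hφ₁η⟩ := exists_map_comp_toCompletion β₁
  obtain ⟨φ₂, hφ₂c, hφ₂η⟩ := exists_map_comp_toCompletion β₂
  have hpow : ∀ n : Multiplicative ℤ, (ofAdd (1 : ℤ)) ^ (toAdd n) = n := fun n => by
    rw [← ofAdd_zsmul, smul_eq_mul, mul_one, ofAdd_toAdd]
  -- `β̂₁ ∘ (1 ↦ a) = id`, `β̂₁ ∘ (1 ↦ b) = 1`, `β̂₂ ∘ (1 ↦ a) = 1`, `β̂₂ ∘ (1 ↦ b) = id`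
  have h11 : ∀ u, φ₁ (ιa u) = u := fun u => by
    have h := eq_of_forall_apply_toCompletion_eq (F := φ₁.comp ιa) (F' := MonoidHom.id _)
      (hφ₁c.comp hιac) continuous_id fun n => by
        rw [MonoidHom.comp_apply, hιaη, hφ₁η, zpowersHom_apply, map_zpow, h1a, hpow]
        rfl
    exact DFunLike.congr_fun h u
  have h12 : ∀ u, φ₁ (ιb u) = 1 := fun u => by
    have h := eq_of_forall_apply_toCompletion_eq (F := φ₁.comp ιb) (F' := 1)
      (hφ₁c.comp hιbc) continuous_const fun n => by
        rw [MonoidHom.comp_apply, hιbη, hφ₁η, zpowersHom_apply, map_zpow, h1b, one_zpow, map_one,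
          MonoidHom.one_apply]
    exact DFunLike.congr_fun h u
  have h22 : ∀ u, φ₂ (ιb u) = u := fun u => by
    have h := eq_of_forall_apply_toCompletion_eq (F := φ₂.comp ιb) (F' := MonoidHom.id _)
      (hφ₂c.comp hιbc) continuous_id fun n => by
        rw [MonoidHom.comp_apply, hιbη, hφ₂η, zpowersHom_apply, map_zpow, h2b, hpow]
        rfl
    exact DFunLike.congr_fun h u
  have h21 : ∀ u, φ₂ (ιa u) = 1 := fun u => by
    have h := eq_of_forall_apply_toCompletion_eq (F := φ₂.comp ιa) (F' := 1)
      (hφ₂c.comp hιac) continuous_const fun n => by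
        rw [MonoidHom.comp_apply, hιaη, hφ₂η, zpowersHom_apply, map_zpow, h2a, one_zpow, map_one,
          MonoidHom.one_apply]
    exact DFunLike.congr_fun h u
  -- `ι(T̂_a), ι(T̂_b) ⊆ N̂`
  have hNcl : IsClosed (FreeOrSurface.commutatorKernel G : Set (profiniteCompletion G)) :=
    Subgroup.isClosed_topologicalClosure _
  have hmemA : ∀ u, ι (ιa u) ∈ FreeOrSurface.commutatorKernel G := fun u => by
    have h := apply_mem_closure_of_forall (F := fun v => ι (ιa v)) (hιc.comp hιac)
      (s := (FreeOrSurface.commutatorKernel G : Set (profiniteCompletion G))) (fun n => by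
        change ι (ιa (toCompletion _ n)) ∈ FreeOrSurface.commutatorKernel G
        rw [hιaη, hιη, zpowersHom_apply, SubgroupClass.coe_zpow, map_zpow]
        exact Subgroup.zpow_mem _ ha _) u
    rwa [hNcl.closure_eq] at h
  have hmemB : ∀ u, ι (ιb u) ∈ FreeOrSurface.commutatorKernel G := fun u => by
    have h := apply_mem_closure_of_forall (F := fun v => ι (ιb v)) (hιc.comp hιbc)
      (s := (FreeOrSurface.commutatorKernel G : Set (profiniteCompletion G))) (fun n => by
        change ι (ιb (toCompletion _ n)) ∈ FreeOrSurface.commutatorKernel G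
        rw [hιbη, hιη, zpowersHom_apply, SubgroupClass.coe_zpow, map_zpow]
        exact Subgroup.zpow_mem _ hb _) u
    rwa [hNcl.closure_eq] at h
  have hzc := Subgroup.mem_centralizer_iff.mp hz
  -- `w` centralises `T̂_a` and `T̂_b`
  have hwA : w ∈ Subgroup.centralizer (ιa.range : Set (profiniteCompletion K)) := by
    refine Subgroup.mem_centralizer_iff.mpr ?_
    rintro _ ⟨u, rfl⟩
    apply hιi
    rw [map_mul, map_mul]
    exact hzc _ (hmemA u)
  have hwB : w ∈ Subgroup.centralizer (ιb.range : Set (profiniteCompletion K)) := by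
    refine Subgroup.mem_centralizer_iff.mpr ?_
    rintro _ ⟨u, rfl⟩
    apply hιi
    rw [map_mul, map_mul]
    exact hzc _ (hmemB u)
  -- `β̂₁` is bijective on `T̂_a`, `β̂₂` on `T̂_b`
  have hTa : Function.Bijective (φ₁.comp ιa.range.subtype) := by
    constructor
    · rintro ⟨_, u, rfl⟩ ⟨_, u', rfl⟩ h
      have h' : φ₁ (ιa u) = φ₁ (ιa u') := h
      rw [h11, h11] at h'
      subst h'
      rfl
    · intro c
      exact ⟨⟨ιa c, c, rfl⟩, h11 c⟩
  have hTb : Function.Bijective (φ₂.comp ιb.range.subtype) := by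
    constructor
    · rintro ⟨_, u, rfl⟩ ⟨_, u', rfl⟩ h
      have h' : φ₂ (ιb u) = φ₂ (ιb u') := h
      rw [h22, h22] at h'
      subst h'
      rfl
    · intro c
      exact ⟨⟨ιb c, c, rfl⟩, h22 c⟩
  -- Lemma 2.7 (v), core: `Z(T̂) ⊆ T̂`
  obtain ⟨u, hu⟩ : w ∈ ιa.range := centralizer_le_of_zHat_of_noBasisCharacter hN _ φ₁ hφ₁c hTa hwA
  obtain ⟨v, hv⟩ : w ∈ ιb.range := centralizer_le_of_zHat_of_noBasisCharacter hN _ φ₂ hφ₂c hTb hwB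
  -- `β̂₁(w) = 1` from `w ∈ T̂_b`, so `w = 1` from `w ∈ T̂_a`
  have hw1 : φ₁ w = 1 := by rw [← hv, h12]
  have hu1 : u = 1 := by rw [← h11 u, hu, hw1]
  rw [← hu, hu1, map_one, map_one]

/-! ### Lemma 2.7 (vi), (vii) for orientable surface groups, modulo F_cov -/

namespace FreeOrSurface

/-- **Lemma 2.7 (vi) for an orientable surface group `G`, by the printed route, modulo F_cov**:
`Z_Ĝ(N̂) = {1}`.  Steps (p. 59): non-commuting `x, y ∈ [G, G]`; Lemma 2.7 (iii) gives `G₁`, `n` with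
`xⁿ, yⁿ ∈ G₁` independent in `G₁^{ab}`; on a finite-index `K ⊆ G₁` the printed `β : K ↠ ℤ × ℤ` with
`β(xⁿ) = (1,0)`, `β(yⁿ) = (0,1)`; `K` is an orientable surface group (F_cov), so it has no basis
character (Lemma 2.7 (v) core, modulo F_cov) and `Z_Ĝ(N̂) ∩ closure(η(K)) = 1`; finally `Z_Ĝ(N̂)` is
normal and meets the open normal level subgroup `Ĝ(N₀)`, `N₀ =` the normal core of `K`, trivially, so
it commutes with it and is killed by the slimness of `Ĝ`.  [Stb2] is not used.
[cite: Mochizuki2012, Lem 2.7(vi) p.59] -/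
theorem centralizerCommutatorKernel_eq_bot_surfaceCase_of_finiteIndexSubgroup
    (hF : SurfaceGroupFiniteIndexSubgroup) (G : Type u) [Group G] (hG : IsOrientableSurfaceGroup G) :
    Subgroup.centralizer (commutatorKernel G : Set (profiniteCompletion G)) = ⊥ := by
  classical
  -- (iii): `G₁`, `n`, independence of `xⁿ, yⁿ` in `G₁^{ab}`
  obtain ⟨x, hx, y, hy, hxy⟩ := exists_noncomm_mem_commutator_surfaceCase G hG
  obtain ⟨G₁, n, hxn, hyn, hG₁, -, hind⟩ := rankTwoInAbelianization_holds G (Or.inr hG) x y hxy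
  haveI := hG₁
  haveI : Group.FG G := by
    obtain ⟨g, -, ⟨e⟩⟩ := hG
    haveI := fg_surfaceGroup g
    exact Group.fg_of_surjective (f := e.symm.toMonoidHom) e.symm.surjective
  -- the printed `β` on a finite-index `L ⊆ G₁`, transported to `K = L ⊆ G`
  obtain ⟨L, hL, haL, hbL, β₁, β₂, h1a, h1b, h2a, h2b⟩ :=
    exists_finiteIndex_kronecker G₁ ⟨x ^ n, hxn⟩ ⟨y ^ n, hyn⟩ hind
  haveI := hL
  let K : Subgroup G := L.map G₁.subtype
  haveI hKfi : K.FiniteIndex :=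
    ⟨by rw [Subgroup.index_map_subtype]; exact mul_ne_zero hL.index_ne_zero hG₁.index_ne_zero⟩
  let eK : L ≃* K := L.equivMapOfInjective G₁.subtype G₁.subtype_injective
  have heK : ∀ l : L, ((eK l : K) : G) = ((l : G₁) : G) := fun l =>
    Subgroup.coe_equivMapOfInjective_apply L G₁.subtype G₁.subtype_injective l
  let a : K := eK ⟨⟨x ^ n, hxn⟩, haL⟩
  let b : K := eK ⟨⟨y ^ n, hyn⟩, hbL⟩
  have haG : (a : G) = x ^ n := heK _
  have hbG : (b : G) = y ^ n := heK _
  have ha : toCompletion G (a : G) ∈ commutatorKernel G := by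
    rw [haG, map_pow]
    exact Subgroup.pow_mem _ (toCompletion_mem_commutatorKernel G hx) n
  have hb : toCompletion G (b : G) ∈ commutatorKernel G := by
    rw [hbG, map_pow]
    exact Subgroup.pow_mem _ (toCompletion_mem_commutatorKernel G hy) n
  let β₁' : K →* Multiplicative ℤ := β₁.comp eK.symm.toMonoidHom
  let β₂' : K →* Multiplicative ℤ := β₂.comp eK.symm.toMonoidHom
  have h1a' : β₁' a = ofAdd 1 := by
    change β₁ (eK.symm (eK _)) = _
    rw [MulEquiv.symm_apply_apply, h1a]
  have h1b' : β₁' b = 1 := by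
    change β₁ (eK.symm (eK _)) = _
    rw [MulEquiv.symm_apply_apply, h1b]
  have h2a' : β₂' a = 1 := by
    change β₂ (eK.symm (eK _)) = _
    rw [MulEquiv.symm_apply_apply, h2a]
  have h2b' : β₂' b = ofAdd 1 := by
    change β₂ (eK.symm (eK _)) = _
    rw [MulEquiv.symm_apply_apply, h2b]
  -- `K` is an orientable surface group (F_cov): no basis character (Lemma 2.7 (v) core, mod F_cov)
  have hK : IsOrientableSurfaceGroup K := hG.subgroup_of_finiteIndex hF K
  have hN := ProfiniteCompletion.noBasisCharacter_of_finiteIndexSubgroup hF hK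
  -- `Z_Ĝ(N̂) ∩ closure(η K) = 1`
  have hA : ∀ z ∈ Subgroup.centralizer (commutatorKernel G : Set (profiniteCompletion G)),
      z ∈ closure (toCompletion G '' (K : Set G)) → z = 1 := fun z hz hzK =>
    eq_one_of_mem_centralizer_commutatorKernel_of_mem_closure K hN a b ha hb β₁' β₂' h1a' h1b' h2a'
      h2b' hz hzK
  -- the open normal level subgroup `Ĝ(N₀) ⊆ closure(η K)`, `N₀` the normal core of `K`
  let N₀ : FiniteIndexNormalSubgroup G := FiniteIndexNormalSubgroup.ofSubgroup K.normalCore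
  let π : profiniteCompletion G →* (diagram (GrpCat.of G)).obj N₀ :=
    MonoidHom.mk' (fun v : profiniteCompletion G => v.val N₀) fun _ _ => rfl
  haveI : DiscreteTopology ((diagram (GrpCat.of G)).obj N₀) := ⟨rfl⟩
  have hπc : Continuous π := continuous_val N₀
  have hUo : IsOpen ((π.ker : Subgroup (profiniteCompletion G)) : Set (profiniteCompletion G)) := by
    change IsOpen (π ⁻¹' {1})
    exact (isOpen_discrete _).preimage hπc
  have hUK : ∀ v ∈ π.ker, v ∈ closure (toCompletion G '' (K : Set G)) := fun v hv => by
    refine (mem_closure_image_iff_val_mem N₀ K.normalCore_le v).mpr ?_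
    have hv' : v.val N₀ = 1 := hv
    rw [hv']
    exact one_mem _
  -- `Z_Ĝ(N̂)` is normal and meets `Ĝ(N₀)` trivially, hence commutes with it
  haveI hNn : (commutatorKernel G).Normal :=
    Subgroup.is_normal_topologicalClosure (commutator (profiniteCompletion G))
  rw [eq_bot_iff]
  intro z hz
  rw [Subgroup.mem_bot]
  refine eq_one_of_forall_mem_isOpen_commute G hG π.ker hUo fun v hv => ?_
  -- the commutator `[z, v]` lies in `Z_Ĝ(N̂) ∩ Ĝ(N₀)`
  have hc1 : z * v * z⁻¹ * v⁻¹ ∈ Subgroup.centralizer (commutatorKernel G : Set (profiniteCompletion G)) := by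
    have h1 : v * z⁻¹ * v⁻¹ ∈ Subgroup.centralizer (commutatorKernel G : Set (profiniteCompletion G)) :=
      (Subgroup.normal_centralizer.conj_mem _ (Subgroup.inv_mem _ hz) v)
    have h2 := Subgroup.mul_mem _ hz h1
    simpa only [mul_assoc] using h2
  have hc2 : z * v * z⁻¹ * v⁻¹ ∈ π.ker := by
    have h1 : z * v * z⁻¹ ∈ π.ker := (MonoidHom.normal_ker π).conj_mem v hv z
    exact Subgroup.mul_mem _ h1 (Subgroup.inv_mem _ hv)
  have hc := hA _ hc1 (hUK _ hc2)
  -- hence `v z = z v`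
  have : z * v = v * z := by
    calc z * v = z * v * z⁻¹ * v⁻¹ * (v * z) := by group
      _ = v * z := by rw [hc, one_mul]
  exact this.symm

/-- **[IUTchI] Lemma 2.7 (vi) AS TYPED, modulo F_cov only** (free half: abc-iut-L5-t9, unconditional;
orientable-surface half: the printed route above).  CONDITIONAL on the named fact
`SurfaceGroupFiniteIndexSubgroup`; [Stb2] is not used. [cite: Mochizuki2012, Lem 2.7(vi) p.59] -/
theorem centralizerCommutatorKernelTrivial_of_finiteIndexSubgroup (hF : SurfaceGroupFiniteIndexSubgroup) :
    Literature.IUT.HodgeTheaters.FreeOrSurface.centralizerCommutatorKernelTrivial.{u} :=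
  centralizerCommutatorKernelTrivial_of_surfaceCase fun G _ hG _ =>
    centralizerCommutatorKernel_eq_bot_surfaceCase_of_finiteIndexSubgroup hF G hG

/-- **[IUTchI] Lemma 2.7 (vii) AS TYPED, modulo F_cov only** ((vi) ⇒ (vii), p. 59, abc-iut-L5-t1's
`autFixingCommutatorKernelTrivial_of_centralizer`).  CONDITIONAL on `SurfaceGroupFiniteIndexSubgroup`;
[Stb2] is not used. [cite: Mochizuki2012, Lem 2.7(vii) p.59] -/
theorem autFixingCommutatorKernelTrivial_of_finiteIndexSubgroup (hF : SurfaceGroupFiniteIndexSubgroup) :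
    Literature.IUT.HodgeTheaters.FreeOrSurface.autFixingCommutatorKernelTrivial.{u} :=
  autFixingCommutatorKernelTrivial_of_centralizer (centralizerCommutatorKernelTrivial_of_finiteIndexSubgroup hF)

/-- **[IUTchI] Lemma 2.7 (vi) AS TYPED — DISCHARGED, no hypotheses**: for `G` nonabelian, free of finite
rank or an orientable surface group, the centralizer `Z_Ĝ(N̂)` of `N̂ = Ker(Ĝ ↠ Ĝ^{ab})` in the profinite
completion `Ĝ` is trivial.  Free half: abc-iut-L5-t9; surface half: the printed route of this file, with
F_cov supplied by abc-iut-L5-d3 / L5-t16's theorem `surfaceGroupFiniteIndexSubgroup_holds`; [Stb2] not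
used. [cite: Mochizuki2012, Lem 2.7(vi) p.58] -/
theorem centralizerCommutatorKernelTrivial_holds :
    Literature.IUT.HodgeTheaters.FreeOrSurface.centralizerCommutatorKernelTrivial.{u} :=
  centralizerCommutatorKernelTrivial_of_finiteIndexSubgroup
    Literature.GroupTheory.CombinatorialGroupTheory.surfaceGroupFiniteIndexSubgroup_holds

/-- **[IUTchI] Lemma 2.7 (vii) AS TYPED — DISCHARGED, no hypotheses**: an automorphism of the profinite
group `Ĝ` (`G` as in (vi)) that restricts to the identity on `N̂` is the identity.
[cite: Mochizuki2012, Lem 2.7(vii) p.58] -/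
theorem autFixingCommutatorKernelTrivial_holds :
    Literature.IUT.HodgeTheaters.FreeOrSurface.autFixingCommutatorKernelTrivial.{u} :=
  autFixingCommutatorKernelTrivial_of_finiteIndexSubgroup
    Literature.GroupTheory.CombinatorialGroupTheory.surfaceGroupFiniteIndexSubgroup_holds

end FreeOrSurface

end Literature.IUT.HodgeTheaters
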